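import Mathlib

/-!
# Sketch — crux-ideate stmt-Parity-11327 (LinearCappedRepulsion), ideator 2

First lemmas of the line `harmonic-majorant-jensen` (one-sided tilted majorant + Jensen with the
circle MEAN, centred at the free point z = 1).  Statements only; nothing here is proved.
`s(n) = Σ_{p^v ∥ n} min(v,2)` is written inline exactly as in the crux
(`n.factorization.sum fun _ v => min v 2`), and `P_x(z) = Σ_{0 ≤ n ≤ x} z^{s(n)}`.
-/

namespace Summit.Parity.BatemanHorn.Cruxes.LinearCappedRepulsion.HarmonicMajorantJensen

open scoped BigOperators

/-- The crux, restated verbatim for the composition check (route decl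
`Summit.Parity.BatemanHorn.Theses.AlmostPrimeZeros.LinearCappedRepulsion`). -/
def Crux : Prop :=
  ∃ C : ℝ, ∀ x : ℕ, 2 ≤ x → ((∑ n ∈ Finset.range (x + 1), (Polynomial.X : Polynomial ℂ) ^
    (n.factorization.sum fun _ v => min v 2)).roots.map
      (fun ρ : ℂ => (‖(1 : ℂ) - ρ‖ ^ 2)⁻¹)).sum ≤ C

/-- **First lemma (the engine, C⁺): uniform one-sided tilted majorant.**  For all `x ≥ 3` and all
complex `z` in the disc `‖z − 1‖ ≤ (log log x)/C` the almost-prime polynomial obeys the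
Landau–Selberg–Delange SIZE with the harmonic exponent `Re z − 1` and a loss depending on
`‖z − 1‖` only:  `|Σ_{n ≤ x} z^{s(n)}| ≤ C x (log x)^{Re z − 1} exp(C ‖z−1‖ log(‖z−1‖+2))`.
No main term, no lower bound, no asymptotics.  (Expected proof: the tree's keyhole/Hankel
machinery of `SatheSelbergMeanValue.lean` run in majorant mode with `R := ‖z‖`, whose constants are
already of the explicit shape `exp(R·C₀)`; the capped Euler factor is bounded by
`exp(O(|z| log log |z|))`; the Hankel loop is bounded by `2πe + 2Γ(1 + |Re z|)` instead of being
evaluated.) -/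
def UniformTiltedMajorant : Prop :=
  ∃ C : ℝ, 0 < C ∧ ∀ x : ℕ, 3 ≤ x → ∀ z : ℂ, ‖z - 1‖ ≤ Real.log (Real.log x) / C →
    ‖∑ n ∈ Finset.range (x + 1), z ^ (n.factorization.sum fun _ v => min v 2)‖ ≤
      C * x * Real.log x ^ (z.re - 1) * Real.exp (C * ‖z - 1‖ * Real.log (‖z - 1‖ + 2))

/-- **Support (provable now, Rankin / Hall–Tenenbaum Thm 01): real-axis majorant for every
`y ≥ 1`.**  `Σ_{n ≤ x} y^{s(n)} ≤ B x (log x)^{y−1} exp(B y log(y+1))`; by positivity of the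
coefficients this bounds `|P_x(z)|` on every circle `|z − 1| = r` by its value at `1 + r`, which is
all the FAR zeros (`|ρ − 1| > (log log x)/C`) need. -/
def RankinMajorant : Prop :=
  ∃ B : ℝ, ∀ x : ℕ, 3 ≤ x → ∀ y : ℝ, 1 ≤ y →
    ∑ n ∈ Finset.range (x + 1), y ^ (n.factorization.sum fun _ v => min v 2) ≤
      B * x * Real.log x ^ (y - 1) * Real.exp (B * y * Real.log (y + 1))

/-- **Support (provable now, pure complex analysis: Jensen's formula with the circle MEAN,
Mathlib `AnalyticOnNhd.circleAverage_log_norm`, tree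
`Literature.Analysis.Complex.sum_divisor_le_of_circleAverage_le`, `circleAverage_re_eq`): the
conversion lemma.**  For a complex polynomial `P` with `P(1) ≠ 0`: a majorant on the disc
`|z − 1| ≤ R₁` of the form `|P(1)|·exp(Λ Re(z−1) + A(1+|z−1|)^{3/2})` (harmonic exponential ×
subquadratic loss) together with a crude global majorant `|P(1)| exp(Λ|z−1| + B(1+|z−1|)^{3/2})`
bounds the zero statistic `Σ_ρ |1−ρ|⁻²` by a constant depending only on `A`, `B` and the ratio
`Λ/R₁` — because the circle mean of the harmonic term `Λ Re(z−1)` over `|z−1| = R` vanishes, the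
zero-free disc `|z−1| < e^{−A·2^{3/2}}` comes from Jensen at radius 1 (Blaschke), and the tail
`∫_{R₁/e}^∞ (2eΛt + B(1+et)^{3/2}) t⁻³ dt` is `O(Λ/R₁ + B)`. -/
def JensenConversion : Prop :=
  ∀ A B K₀ : ℝ, ∃ K : ℝ, ∀ (P : Polynomial ℂ) (Λ R₁ : ℝ), P.eval 1 ≠ 0 → 1 ≤ R₁ → 0 ≤ Λ →
    Λ ≤ K₀ * R₁ →
    (∀ z : ℂ, ‖z - 1‖ ≤ R₁ →
      ‖P.eval z‖ ≤ ‖P.eval 1‖ * Real.exp (Λ * (z.re - 1) + A * (1 + ‖z - 1‖) ^ (3 / 2 : ℝ))) →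
    (∀ z : ℂ, ‖P.eval z‖ ≤ ‖P.eval 1‖ * Real.exp (Λ * ‖z - 1‖ + B * (1 + ‖z - 1‖) ^ (3 / 2 : ℝ))) →
    (P.roots.map (fun ρ : ℂ => (‖(1 : ℂ) - ρ‖ ^ 2)⁻¹)).sum ≤ K

/-- The composition the crux-plan stage would register (bookkeeping: `|P_x(z)| ≤ P_x(|z|) ≤
P_x(1 + |z−1|)` by positivity and monotonicity, `Λ := log log x`, `R₁ := Λ/C`, finitely many
`x < exp(exp C)` absorbed into the constant). Stated, not proved. -/
def Composition : Prop :=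
  UniformTiltedMajorant → RankinMajorant → JensenConversion → Crux

/-- Calibration (necessity side, provable now from the route's support items
`HadamardBookkeeping` + `SystemMertens` at `f = X`): the crux forces signed
Landau–Selberg–Delange savings on the negative axis, e.g. at `z = −1` a prime-number-theorem-type
bound for the Liouville-like function `(−1)^{s(n)}`. -/
def NegativeAxisShadow : Prop :=
  Crux → ∃ C : ℝ, ∀ x : ℕ, 3 ≤ x →
    ‖∑ n ∈ Finset.range (x + 1), (-1 : ℂ) ^ (n.factorization.sum fun _ v => min v 2)‖ ≤
      C * x / Real.log x ^ 2

end Summit.Parity.BatemanHorn.Cruxes.LinearCappedRepulsion.HarmonicMajorantJensen
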